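import Mathlib.Analysis.Calculus.IteratedDeriv.Lemmas
import Mathlib.Analysis.Calculus.Deriv.ZPow
import Mathlib.Analysis.Calculus.ContDiff.Operations
import Mathlib.Algebra.BigOperators.Field
import HarnessLib

/-!
# Divided derivatives `f^{(j)}(x) / j!`

Topic `Literature/Analysis/Calculus`. The *divided* (normalised) derivative
`divDeriv j f x = f^{(j)}(x)/j!` — the `j`-th Taylor coefficient of `f` at `x` — over an
arbitrary nontrivially normed field `𝕜` (used at `𝕜 = ℚ`, where it carries the arithmetic of the
hypergeometric constructions of linear forms in zeta values: Nesterenko's "bricks"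
[Zudilin2004, §7], the Nikishin–Rivoal scheme, Zudilin's `Φ`; and at `𝕜 = ℝ, ℂ`).
In this normalisation the Leibniz rule has no binomial coefficients,
`𝒟ⱼ(fg) = ∑_{i ≤ j} 𝒟ᵢ f · 𝒟_{j-i} g`, which is what makes statements of the form
"`dʲ 𝒟ⱼ f(x) ∈ ℤ` for all `j`" multiplicative. Everything here is PROVED (no named facts).

## Contents

* `divDeriv`, `divDeriv_zero`, `iteratedDeriv_eq_factorial_mul_divDeriv`, congruence under
  `=ᶠ[𝓝 x]` (`divDeriv_congr`), linearity (`divDeriv_add`, `divDeriv_sub`, `divDeriv_const_mul`,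
  `divDeriv_sum`), the Leibniz rule `divDeriv_mul` / `divDeriv_fun_mul`;
* translation and reflection: `divDeriv_comp_add_const`, `divDeriv_comp_sub_const`,
  `divDeriv_comp_neg`;
* the basic germs: `divDeriv_pow_zero` (`𝒟ⱼ[tᵐ](0) = δ_{jm}`), `divDeriv_sub_pow`
  (`𝒟ⱼ[(t-a)ᵐ](a) = δ_{jm}`), `divDeriv_sub_pow_mul` (`𝒟ⱼ[(t-a)ᵐ g](a) = 𝒟_{j-m} g(a)`, zero for
  `j < m`), `divDeriv_inv_add_const` (`𝒟ⱼ[(t+c)⁻¹](x) = (-1)ʲ/(x+c)^{j+1}`), and the smoothness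
  lemma `contDiffAt_inv_add_const`.

## References

* [Zudilin2004] W. Zudilin, *Arithmetic of linear forms involving odd zeta values*, J. Théor.
  Nombres Bordeaux 16 (2004), 251–291, §7 (the operators `(1/j!) d^j/dt^j` on rational bricks).
-/

noncomputable section

open Filter Topology Finset
open scoped Nat

namespace Literature.Analysis.Calculus

variable {𝕜 : Type*} [NontriviallyNormedField 𝕜]

/-- The **divided derivative** `𝒟ⱼ f (x) = f^{(j)}(x) / j!`, i.e. the `j`-th Taylor coefficient
of `f` at `x` (the operator `(1/j!) dʲ/dtʲ` of [Zudilin2004, §7]). [folklore] -/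
def divDeriv (j : ℕ) (f : 𝕜 → 𝕜) (x : 𝕜) : 𝕜 :=
  iteratedDeriv j f x / (j ! : 𝕜)

/-- `𝒟₀ f = f`. [folklore] -/
@[simp] theorem divDeriv_zero (f : 𝕜 → 𝕜) (x : 𝕜) : divDeriv 0 f x = f x := by
  simp [divDeriv]

/-- `f^{(j)}(x) = j! · 𝒟ⱼ f(x)` (characteristic zero). [folklore] -/
theorem iteratedDeriv_eq_factorial_mul_divDeriv [CharZero 𝕜] (j : ℕ) (f : 𝕜 → 𝕜) (x : 𝕜) :
    iteratedDeriv j f x = (j ! : 𝕜) * divDeriv j f x := by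
  have h : (j ! : 𝕜) ≠ 0 := by exact_mod_cast (Nat.factorial_pos j).ne'
  rw [divDeriv, mul_div_cancel₀ _ h]

/-- Divided derivatives only depend on the germ. [folklore] -/
theorem divDeriv_congr {j : ℕ} {f g : 𝕜 → 𝕜} {x : 𝕜} (h : f =ᶠ[𝓝 x] g) :
    divDeriv j f x = divDeriv j g x := by
  rw [divDeriv, divDeriv, (h.iteratedDeriv j).eq_of_nhds]

/-! ### Linearity -/

/-- Additivity. [folklore] -/
theorem divDeriv_add {j : ℕ} {f g : 𝕜 → 𝕜} {x : 𝕜} (hf : ContDiffAt 𝕜 j f x)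
    (hg : ContDiffAt 𝕜 j g x) : divDeriv j (f + g) x = divDeriv j f x + divDeriv j g x := by
  rw [divDeriv, divDeriv, divDeriv, iteratedDeriv_add hf hg, add_div]

/-- Additivity (`fun` form). [folklore] -/
theorem divDeriv_fun_add {j : ℕ} {f g : 𝕜 → 𝕜} {x : 𝕜} (hf : ContDiffAt 𝕜 j f x)
    (hg : ContDiffAt 𝕜 j g x) :
    divDeriv j (fun t => f t + g t) x = divDeriv j f x + divDeriv j g x :=
  divDeriv_add hf hg

/-- Subtraction. [folklore] -/
theorem divDeriv_sub {j : ℕ} {f g : 𝕜 → 𝕜} {x : 𝕜} (hf : ContDiffAt 𝕜 j f x)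
    (hg : ContDiffAt 𝕜 j g x) : divDeriv j (f - g) x = divDeriv j f x - divDeriv j g x := by
  rw [divDeriv, divDeriv, divDeriv, iteratedDeriv_sub hf hg, sub_div]

/-- Negation. [folklore] -/
@[simp] theorem divDeriv_neg (j : ℕ) (f : 𝕜 → 𝕜) (x : 𝕜) :
    divDeriv j (fun t => -f t) x = -divDeriv j f x := by
  rw [divDeriv, divDeriv, iteratedDeriv_fun_neg, neg_div]

/-- Constant multiples. [folklore] -/
@[simp] theorem divDeriv_const_mul (j : ℕ) (c : 𝕜) (f : 𝕜 → 𝕜) (x : 𝕜) :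
    divDeriv j (fun t => c * f t) x = c * divDeriv j f x := by
  rw [divDeriv, divDeriv, iteratedDeriv_const_mul_field, mul_div_assoc]

/-- Constants: `𝒟ⱼ c = 0` for `j ≥ 1`, `= c` for `j = 0`. [folklore] -/
@[simp] theorem divDeriv_const (j : ℕ) (c x : 𝕜) :
    divDeriv j (fun _ : 𝕜 => c) x = if j = 0 then c else 0 := by
  rcases Nat.eq_zero_or_pos j with rfl | hj
  · simp
  · simp [divDeriv, iteratedDeriv_const, hj.ne']

/-- Finite sums. [folklore] -/
theorem divDeriv_sum {ι : Type*} {I : Finset ι} {j : ℕ} {f : ι → 𝕜 → 𝕜} {x : 𝕜}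
    (hf : ∀ i ∈ I, ContDiffAt 𝕜 j (f i) x) :
    divDeriv j (fun t => ∑ i ∈ I, f i t) x = ∑ i ∈ I, divDeriv j (f i) x := by
  rw [divDeriv, iteratedDeriv_fun_sum hf, sum_div]
  rfl

/-! ### The Leibniz rule -/

/-- **Leibniz rule for divided derivatives**: `𝒟ⱼ(fg)(x) = ∑_{i=0}^{j} 𝒟ᵢ f(x) · 𝒟_{j-i} g(x)`
(no binomial coefficients). [folklore] -/
theorem divDeriv_mul [CharZero 𝕜] {j : ℕ} {f g : 𝕜 → 𝕜} {x : 𝕜} (hf : ContDiffAt 𝕜 j f x)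
    (hg : ContDiffAt 𝕜 j g x) :
    divDeriv j (f * g) x = ∑ i ∈ range (j + 1), divDeriv i f x * divDeriv (j - i) g x := by
  rw [divDeriv, iteratedDeriv_mul hf hg, sum_div]
  refine sum_congr rfl fun i hi => ?_
  have hij : i ≤ j := Nat.lt_succ_iff.1 (mem_range.1 hi)
  rw [divDeriv, divDeriv]
  have hi0 : (i ! : 𝕜) ≠ 0 := by exact_mod_cast (Nat.factorial_pos i).ne'
  have hji0 : ((j - i)! : 𝕜) ≠ 0 := by exact_mod_cast (Nat.factorial_pos (j - i)).ne'
  have hj0 : (j ! : 𝕜) ≠ 0 := by exact_mod_cast (Nat.factorial_pos j).ne'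
  have hchoose : ((j.choose i : ℕ) : 𝕜) * (i ! : 𝕜) * ((j - i)! : 𝕜) = (j ! : 𝕜) := by
    exact_mod_cast Nat.choose_mul_factorial_mul_factorial hij
  field_simp
  rw [← hchoose]
  ring

/-- Leibniz rule, `fun` form. [folklore] -/
theorem divDeriv_fun_mul [CharZero 𝕜] {j : ℕ} {f g : 𝕜 → 𝕜} {x : 𝕜} (hf : ContDiffAt 𝕜 j f x)
    (hg : ContDiffAt 𝕜 j g x) :
    divDeriv j (fun t => f t * g t) x = ∑ i ∈ range (j + 1), divDeriv i f x * divDeriv (j - i) g x :=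
  divDeriv_mul hf hg

/-! ### Translation and reflection -/

/-- `𝒟ⱼ[f(t + c)](x) = 𝒟ⱼ f(x + c)`. [folklore] -/
theorem divDeriv_comp_add_const (j : ℕ) (f : 𝕜 → 𝕜) (c x : 𝕜) :
    divDeriv j (fun t => f (t + c)) x = divDeriv j f (x + c) := by
  rw [divDeriv, divDeriv, iteratedDeriv_comp_add_const]

/-- `𝒟ⱼ[f(t - c)](x) = 𝒟ⱼ f(x - c)`. [folklore] -/
theorem divDeriv_comp_sub_const (j : ℕ) (f : 𝕜 → 𝕜) (c x : 𝕜) :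
    divDeriv j (fun t => f (t - c)) x = divDeriv j f (x - c) := by
  rw [divDeriv, divDeriv, iteratedDeriv_comp_sub_const]

/-- `𝒟ⱼ[f(-t)](x) = (-1)ʲ 𝒟ⱼ f(-x)`. [folklore] -/
theorem divDeriv_comp_neg (j : ℕ) (f : 𝕜 → 𝕜) (x : 𝕜) :
    divDeriv j (fun t => f (-t)) x = (-1) ^ j * divDeriv j f (-x) := by
  rw [divDeriv, divDeriv, iteratedDeriv_comp_neg, smul_eq_mul, mul_div_assoc]

/-! ### Monomials and simple poles -/

/-- `𝒟ⱼ[tᵐ](0) = δ_{jm}`. [folklore] -/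
theorem divDeriv_pow_zero [CharZero 𝕜] (m j : ℕ) :
    divDeriv j (fun t : 𝕜 => t ^ m) 0 = if j = m then 1 else 0 := by
  rw [divDeriv, iteratedDeriv_pow]
  have hj0 : (j ! : 𝕜) ≠ 0 := by exact_mod_cast (Nat.factorial_pos j).ne'
  rcases lt_trichotomy j m with h | rfl | h
  · rw [if_neg h.ne, zero_pow (Nat.sub_ne_zero_of_lt h), mul_zero, zero_div]
  · rw [if_pos rfl, Nat.sub_self, pow_zero, mul_one, Nat.descFactorial_self, div_self hj0]
  · rw [if_neg h.ne', Nat.descFactorial_eq_zero_iff_lt.2 h, Nat.cast_zero, zero_mul, zero_div]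

/-- `𝒟ⱼ[(t - a)ᵐ](a) = δ_{jm}`. [folklore] -/
theorem divDeriv_sub_pow [CharZero 𝕜] (a : 𝕜) (m j : ℕ) :
    divDeriv j (fun t : 𝕜 => (t - a) ^ m) a = if j = m then 1 else 0 := by
  have := divDeriv_comp_sub_const j (fun t : 𝕜 => t ^ m) a a
  rw [this, sub_self, divDeriv_pow_zero]

/-- Smoothness of `(t - a)ᵐ`. [folklore] -/
theorem contDiffAt_sub_pow (a x : 𝕜) (m : ℕ) {n : WithTop ℕ∞} :
    ContDiffAt 𝕜 n (fun t : 𝕜 => (t - a) ^ m) x :=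
  (contDiffAt_id.sub contDiffAt_const).pow m

/-- **Vanishing and shift at a zero**: `𝒟ⱼ[(t - a)ᵐ g(t)](a) = 0` for `j < m` and
`= 𝒟_{j-m} g(a)` for `j ≥ m`. [folklore] -/
theorem divDeriv_sub_pow_mul [CharZero 𝕜] {j : ℕ} {g : 𝕜 → 𝕜} {a : 𝕜}
    (hg : ContDiffAt 𝕜 j g a) (m : ℕ) :
    divDeriv j (fun t => (t - a) ^ m * g t) a = if j < m then 0 else divDeriv (j - m) g a := by
  rw [divDeriv_fun_mul (contDiffAt_sub_pow a a m) hg]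
  simp_rw [divDeriv_sub_pow, ite_mul, one_mul, zero_mul]
  rw [sum_ite_eq']
  by_cases h : j < m
  · rw [if_neg (by simpa using h), if_pos h]
  · rw [if_pos (mem_range.2 (by omega)), if_neg h]

/-- Smoothness of `(t + c)⁻¹` away from `-c`. [folklore] -/
theorem contDiffAt_inv_add_const {x c : 𝕜} (h : x + c ≠ 0) {n : WithTop ℕ∞} :
    ContDiffAt 𝕜 n (fun t : 𝕜 => (t + c)⁻¹) x :=
  (contDiffAt_id.add contDiffAt_const).inv h

/-- **Simple poles**: `𝒟ⱼ[(t + c)⁻¹](x) = (-1)ʲ / (x + c)^{j+1}` for `x + c ≠ 0`. [folklore] -/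
theorem divDeriv_inv_add_const [CharZero 𝕜] (j : ℕ) {x c : 𝕜} (h : x + c ≠ 0) :
    divDeriv j (fun t : 𝕜 => (t + c)⁻¹) x = (-1) ^ j / (x + c) ^ (j + 1) := by
  rw [divDeriv, iteratedDeriv_comp_add_const j (fun t : 𝕜 => t⁻¹) c]
  simp only
  rw [show (fun t : 𝕜 => t⁻¹) = Inv.inv from rfl, iteratedDeriv_eq_iterate, iter_deriv_inv]
  have hj0 : (j ! : 𝕜) ≠ 0 := by exact_mod_cast (Nat.factorial_pos j).ne'
  have hzpow : (x + c) ^ (-1 - (j : ℤ)) = ((x + c) ^ (j + 1))⁻¹ := by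
    rw [show (-1 - (j : ℤ)) = -((j + 1 : ℕ) : ℤ) by push_cast; ring, zpow_neg, zpow_natCast]
  rw [hzpow]
  field_simp

end Literature.Analysis.Calculus
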